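import Summits.ResolutionOfSingularities.ResolutionOfSingularities.Theorems.EquisingularLiftEquisingularLiftNatModelChainStep
import Summits.ResolutionOfSingularities.ResolutionOfSingularities.Theorems.EquisingularLiftEquisingularLiftNatPointResolution
import Summits.ResolutionOfSingularities.ResolutionOfSingularities.Theorems.EquisingularLiftEquisingularLiftProjectiveAmbientIntegralFibre
import Summits.ResolutionOfSingularities.ResolutionOfSingularities.Theorems.EquisingularLiftEquisingularLiftNatStalkDimension
import HarnessLib

/-!
# [OURS · L1 W4.5(b) · EL♮] K5 — THE T-ISO ENGINE WITH SUB-CHAIN SUPPLIERS «DOWNSTAIRS RESOLUTIONS BY GOOD POINTS AND SUPPLIER-MATCHED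
# SUB-CHAINS LIFT», any `n` (res-L1-w45b-lead-2 DESIGN v6/v7 (TC⁺) 2026-08-27T08:21:51Z / LEAD-MEMO-5 «engine K5 = pv-029 (γ)»)

Crux `EquisingularLiftNat` = stmt-ResolutionOfSingularities-20038 (child EL♮(3) = stmt-20148), route EquisingularLift, line `sections`;
helper file `--supports … --as helper` by res-D-pv-029. HONEST FRAMING: OURS (cell res-hironaka, slot W4.5(b)); NOT a statement of
any manuscript. AI-written, weaker than expert review. No `sorry`; standard axioms.

WHAT. `target_elnat_of_subchainResolution` generalises T-ISO-0⁺ (`target_elnat_of_deltaPointResolution_dim`, p519428): instead of ONE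
carrier Δ-step supplied through `HΔ(Adm)`, the downstairs closure may, after a good point step at `x`, jump along ANY `Reach`-admissible
downstairs SUB-CHAIN `(F₉, β : F₉ → F₂, T₉)` (parameter `Reach F₁ F₂ υ x T₂ F₉ β T₉`), and the lift hypothesis becomes the SUB-CHAIN
SUPPLIER `HSUB(Reach)`: in the engine's own context — base `q : P → Spec O` (handed with: `Y` closed irreducible in the special fibre,
`P` integral, locally Noetherian, regular, `q` proper and smooth of relative dimension `n`), an ABSTRACT stage predicate `Ch` closed under
horizontal E1 steps (the closure property is handed over, so the supplier extends chains only through admissible centres) and implying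
`Split.Chain` — and after the point step (the stage `(X', σ', S')` with its model square `j : F₁ → X'`, the section `s` through `j x`
with T-DIM `dim 𝒪_{X',s(𝔪)} = n + 1`, the blow-up `τ₁ : X₁ → X'` of `ker s` with its `Ch`-stage and invariants, the model square
`j₂ : F₂ → X₁` of the point blow-up `υ`, `j₂ ≫ τ₁ = υ ≫ j`, the carrier identity), EVERY `Reach`-admissible `(F₉, β, T₉)` is matched by a
`Ch`-stage `(X₉, σ₉, S₉)` (integral, locally Noetherian, regular, dominant over `O`) with a model square `j₉ : F₉ → X₉`,
`j₉ '' T₉ = S₉`, `T₉` closed irreducible, `F₉` integral. CONCLUSION: T-ISO-0's horizontal EL♮ form.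

USE. Lead-2's v7 (TC⁺) «in-carrier point steps (≤ 1 singular point of the carrier curve) then the carrier curve» (TARGET-TCPLUS
1457ad81086910d2) = this theorem at `Reach := ReachTC⁺` (its inner closure `R` followed by the blow-up of `vanishingIdeal Z₉`) +
`HSUB(ReachTC⁺)` (supplier: res-L1-w45b-stub-1's T-M1-SCHEME / res-type-100's carrier files, running `modelStep` p509016 at each
in-carrier section and at the curve). T-ISO-0⁺ itself = `Reach := one Δ-step`.

PROOF = the model-square induction of p519428 verbatim (K2 `modelStep`, K3b `modelPointStep_chain'`, T-DIM `ringKrullDim_stalk_eq_succ_of_chain`),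
the Δ-branch replaced by one call to `HSUB`.
-/

set_option linter.dupNamespace false -- mandated namespace `Summit.<Summit>.<Problem>` of this single-conjunct summit
set_option linter.overlappingInstances false -- signatures carry `[IsDomain O] [IsDiscreteValuationRing O]`

noncomputable section

open CategoryTheory CategoryTheory.Limits AlgebraicGeometry TopologicalSpace Topology
open MvPolynomial
open Literature.AlgebraicGeometry.Resolution
open AlgebraicGeometry.Scheme.IdealSheafData
open Summit.ResolutionOfSingularities.ResolutionOfSingularities.Theses.EquisingularLift.Split
open Summit.ResolutionOfSingularities.ResolutionOfSingularities.Cruxes.EquisingularLift.StrataSplit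

namespace Summit.ResolutionOfSingularities.ResolutionOfSingularities.Cruxes.EquisingularLiftNat.Sections

/-! ## The rung -/

/-- **K5: the T-ISO engine with sub-chain suppliers** (any `n`; parametric in `Reach`, conditional on `HSUB(Reach)`). See the module
docstring. [folklore; assembly of p509016, p512154, p513633 over the T-ISO-0 base block p505885] -/
theorem target_elnat_of_subchainResolution (p : ℕ) : p.Prime → ∀ (k : Type) [Field k] [CharP k p] [IsAlgClosed k] (n : ℕ)
    (H : AlgebraicGeometry.Scheme.{0}) (ι : H ⟶ (Literature.AlgebraicGeometry.Motives.projectiveSpace n k).left),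
    AlgebraicGeometry.IsClosedImmersion ι → AlgebraicGeometry.IsIntegral H →
    (∀ y : (Literature.AlgebraicGeometry.Motives.projectiveSpace n k).left,
      ∃ U : (Literature.AlgebraicGeometry.Motives.projectiveSpace n k).left.affineOpens,
        y ∈ (U : (Literature.AlgebraicGeometry.Motives.projectiveSpace n k).left.Opens) ∧ (ι.ker.ideal U).IsPrincipal) →
    -- the downstairs admissibility predicate of carrier traces and the LIFT HYPOTHESIS HΔ(Adm)
    ∀ (Reach : ∀ (F₁ F₂ : AlgebraicGeometry.Scheme.{0}), (F₂ ⟶ F₁) → F₁ → Set F₂ →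
      ∀ (F₉ : AlgebraicGeometry.Scheme.{0}), (F₉ ⟶ F₂) → Set F₉ → Prop),
    -- THE SUB-CHAIN SUPPLIER HSUB(Reach): in the engine's context (base `q : P → Spec O`, closed irreducible `Y` in the special
    -- fibre, stage predicate `Ch` closed under horizontal E1 steps and implying `Split.Chain`), after the point step at `x`
    -- (section `s`, blow-up `τ₁`, model squares `j`, `j₂`, carrier identity, T-DIM), every `Reach`-admissible downstairs
    -- sub-chain `(F₉, β, T₉)` is matched by a `Ch`-stage with a model square for `F₉`
    (∀ (O : Type) [CommRing O] [IsDomain O] [IsDiscreteValuationRing O] [IsAdicComplete (IsLocalRing.maximalIdeal O) O]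
        [IsAlgClosed (IsLocalRing.ResidueField O)] (θ : O →+* k), Function.Surjective θ →
      ∀ (P : AlgebraicGeometry.Scheme.{0}) (q : P ⟶ AlgebraicGeometry.Spec (.of O)) (Y : Set P)
        (Ch : ∀ X' : AlgebraicGeometry.Scheme.{0}, (X' ⟶ P) → Set X' → Prop),
        (∀ (X' X'' : AlgebraicGeometry.Scheme.{0}) (σ' : X' ⟶ P) (S' : Set X') (C : X'.IdealSheafData) (τ : X'' ⟶ X'),
          Ch X' σ' S' → Literature.AlgebraicGeometry.Resolution.IsBlowup τ C →
          Literature.AlgebraicGeometry.Resolution.Scheme.IsRegular C.subscheme → AlgebraicGeometry.Flat (C.subschemeι ≫ σ' ≫ q) →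
          σ' '' (C.support : Set X') ⊆ {y | ¬ IsGenericPoint y Y} →
          (C.support : Set X') ∩ (σ' ≫ q) ⁻¹' {IsLocalRing.closedPoint O} ⊆ S' →
          Ch X'' (τ ≫ σ') (closure (τ ⁻¹' (S' \ (C.support : Set X'))))) →
        (∀ (X' : AlgebraicGeometry.Scheme.{0}) (σ' : X' ⟶ P) (S' : Set X'), Ch X' σ' S' →
          Summit.ResolutionOfSingularities.ResolutionOfSingularities.Theses.EquisingularLift.Split.Chain P Y X' σ' S') →
        Y ⊆ q ⁻¹' {IsLocalRing.closedPoint O} → IsIrreducible Y → IsClosed Y →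
        AlgebraicGeometry.IsIntegral P → IsLocallyNoetherian P → Literature.AlgebraicGeometry.Resolution.Scheme.IsRegular P →
        AlgebraicGeometry.IsProper q → AlgebraicGeometry.SmoothOfRelativeDimension n q →
      -- the stage before the point step and its model
      ∀ (X' : AlgebraicGeometry.Scheme.{0}) (σ' : X' ⟶ P) (S' : Set X'), Ch X' σ' S' → AlgebraicGeometry.IsIntegral X' →
        IsLocallyNoetherian X' → Literature.AlgebraicGeometry.Resolution.Scheme.IsRegular X' →
        AlgebraicGeometry.IsDominant (σ' ≫ q) →
      ∀ (F₁ : AlgebraicGeometry.Scheme.{0}), AlgebraicGeometry.IsIntegral F₁ → ∀ (j : F₁ ⟶ X')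
        (t : F₁ ⟶ AlgebraicGeometry.Spec (.of k)),
        IsPullback j t (σ' ≫ q) (AlgebraicGeometry.Spec.map (CommRingCat.ofHom θ)) →
      ∀ (T₁ : Set F₁), IsClosed T₁ → IsIrreducible T₁ → j '' T₁ = S' →
      -- the point step: section, its blow-up, the new stage and its model
      ∀ (x : F₁) (hx : IsClosed ({x} : Set F₁)) (U : X'.Opens), AlgebraicGeometry.Smooth (U.ι ≫ σ' ≫ q) →
      ∀ (s : AlgebraicGeometry.Spec (.of O) ⟶ X'), s ≫ σ' ≫ q = 𝟙 _ → s (IsLocalRing.closedPoint O) ∈ U →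
        s (IsLocalRing.closedPoint O) = j x →
        ringKrullDim (X'.presheaf.stalk (s (IsLocalRing.closedPoint O))) = ((n + 1 : ℕ) : WithBot ℕ∞) →
      ∀ (X₁ : AlgebraicGeometry.Scheme.{0}) (τ₁ : X₁ ⟶ X'), Literature.AlgebraicGeometry.Resolution.IsBlowup τ₁ s.ker →
        AlgebraicGeometry.IsIntegral X₁ → IsLocallyNoetherian X₁ → Literature.AlgebraicGeometry.Resolution.Scheme.IsRegular X₁ →
        AlgebraicGeometry.IsDominant ((τ₁ ≫ σ') ≫ q) →
      ∀ (F₂ : AlgebraicGeometry.Scheme.{0}), AlgebraicGeometry.IsIntegral F₂ → ∀ (υ : F₂ ⟶ F₁),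
        Literature.AlgebraicGeometry.Resolution.IsBlowup υ
          (AlgebraicGeometry.Scheme.IdealSheafData.vanishingIdeal (⟨{x}, hx⟩ : TopologicalSpace.Closeds F₁)) →
      ∀ (j₂ : F₂ ⟶ X₁) (t₂ : F₂ ⟶ AlgebraicGeometry.Spec (.of k)),
        IsPullback j₂ t₂ ((τ₁ ≫ σ') ≫ q) (AlgebraicGeometry.Spec.map (CommRingCat.ofHom θ)) → j₂ ≫ τ₁ = υ ≫ j →
        (s.ker.comap τ₁).comap j₂ =
          (AlgebraicGeometry.Scheme.IdealSheafData.vanishingIdeal (⟨{x}, hx⟩ : TopologicalSpace.Closeds F₁)).comap υ →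
        IsIrreducible (closure (υ ⁻¹' (T₁ \ {x}))) →
        Ch X₁ (τ₁ ≫ σ') (j₂ '' closure (υ ⁻¹' (T₁ \ {x}))) →
      -- the admissible downstairs sub-chains are matched upstairs
      ∀ (F₉ : AlgebraicGeometry.Scheme.{0}) (β : F₉ ⟶ F₂) (T₉ : Set F₉), Reach F₁ F₂ υ x (closure (υ ⁻¹' (T₁ \ {x}))) F₉ β T₉ →
        ∃ (X₉ : AlgebraicGeometry.Scheme.{0}) (σ₉ : X₉ ⟶ P) (S₉ : Set X₉) (j₉ : F₉ ⟶ X₉)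
          (t₉ : F₉ ⟶ AlgebraicGeometry.Spec (.of k)),
          Ch X₉ σ₉ S₉ ∧ AlgebraicGeometry.IsIntegral X₉ ∧ IsLocallyNoetherian X₉ ∧
          Literature.AlgebraicGeometry.Resolution.Scheme.IsRegular X₉ ∧ AlgebraicGeometry.IsDominant (σ₉ ≫ q) ∧
          IsPullback j₉ t₉ (σ₉ ≫ q) (AlgebraicGeometry.Spec.map (CommRingCat.ofHom θ)) ∧ j₉ '' T₉ = S₉ ∧
          IsClosed T₉ ∧ IsIrreducible T₉ ∧ AlgebraicGeometry.IsIntegral F₉) →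
    -- the downstairs resolution by (pt) and (pt;sub-chain) steps
    (∃ (F' : AlgebraicGeometry.Scheme.{0}) (ρ' : F' ⟶ (Literature.AlgebraicGeometry.Motives.projectiveSpace n k).left)
        (T' : Set F'),
      (∀ Q : (∀ F₁ : AlgebraicGeometry.Scheme.{0}, (F₁ ⟶ (Literature.AlgebraicGeometry.Motives.projectiveSpace n k).left) →
          Set F₁ → Prop),
        Q (Literature.AlgebraicGeometry.Motives.projectiveSpace n k).left
          (𝟙 (Literature.AlgebraicGeometry.Motives.projectiveSpace n k).left) (Set.range ι) →
        (∀ (F₁ F₂ : AlgebraicGeometry.Scheme.{0}) (ρ : F₁ ⟶ (Literature.AlgebraicGeometry.Motives.projectiveSpace n k).left)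
            (T₁ : Set F₁)
            (x : ↥(AlgebraicGeometry.Scheme.IdealSheafData.vanishingIdeal
              (⟨closure T₁, isClosed_closure⟩ : TopologicalSpace.Closeds F₁)).subscheme)
            (υ : F₂ ⟶ F₁)
            (hx : IsClosed ({((AlgebraicGeometry.Scheme.IdealSheafData.vanishingIdeal
              (⟨closure T₁, isClosed_closure⟩ : TopologicalSpace.Closeds F₁)).subschemeι x : F₁)} : Set F₁)),
          Q F₁ ρ T₁ →
          ¬ IsRegularLocalRing ((AlgebraicGeometry.Scheme.IdealSheafData.vanishingIdeal
              (⟨closure T₁, isClosed_closure⟩ : TopologicalSpace.Closeds F₁)).subscheme.presheaf.stalk x) →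
          IsRegularLocalRing (F₁.presheaf.stalk ((AlgebraicGeometry.Scheme.IdealSheafData.vanishingIdeal
              (⟨closure T₁, isClosed_closure⟩ : TopologicalSpace.Closeds F₁)).subschemeι x)) →
          Literature.AlgebraicGeometry.Resolution.IsBlowup υ
            (AlgebraicGeometry.Scheme.IdealSheafData.vanishingIdeal
              (⟨{((AlgebraicGeometry.Scheme.IdealSheafData.vanishingIdeal
                (⟨closure T₁, isClosed_closure⟩ : TopologicalSpace.Closeds F₁)).subschemeι x : F₁)}, hx⟩ :
                TopologicalSpace.Closeds F₁)) →
          Q F₂ (υ ≫ ρ) (closure (υ ⁻¹' (T₁ \ {((AlgebraicGeometry.Scheme.IdealSheafData.vanishingIdeal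
              (⟨closure T₁, isClosed_closure⟩ : TopologicalSpace.Closeds F₁)).subschemeι x : F₁)}))) ∧
          (∀ (F₉ : AlgebraicGeometry.Scheme.{0}) (β : F₉ ⟶ F₂) (T₉ : Set F₉),
            Reach F₁ F₂ υ ((AlgebraicGeometry.Scheme.IdealSheafData.vanishingIdeal
                (⟨closure T₁, isClosed_closure⟩ : TopologicalSpace.Closeds F₁)).subschemeι x)
              (closure (υ ⁻¹' (T₁ \ {((AlgebraicGeometry.Scheme.IdealSheafData.vanishingIdeal
                (⟨closure T₁, isClosed_closure⟩ : TopologicalSpace.Closeds F₁)).subschemeι x : F₁)}))) F₉ β T₉ →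
            Q F₉ ((β ≫ υ) ≫ ρ) T₉)) →
        Q F' ρ' T') ∧
      Literature.AlgebraicGeometry.Resolution.Scheme.IsRegular (AlgebraicGeometry.Scheme.IdealSheafData.vanishingIdeal
        (⟨closure T', isClosed_closure⟩ : TopologicalSpace.Closeds F')).subscheme) →
    ∃ (O : Type) (_ : CommRing O) (_ : IsDomain O) (_ : IsDiscreteValuationRing O) (_ : CharZero O) (π : O →+* k),
      Function.Surjective π ∧ (letI := MvPolynomial.gradedAlgebra (σ := Fin (n + 1)) (R := O);
        letI := MvPolynomial.gradedAlgebra (σ := Fin (n + 1)) (R := k);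
        ∀ (φ : MvPolynomial.homogeneousSubmodule (Fin (n + 1)) O →+*ᵍ MvPolynomial.homogeneousSubmodule (Fin (n + 1)) k)
          (hφ' : HomogeneousIdeal.irrelevant (MvPolynomial.homogeneousSubmodule (Fin (n + 1)) k) ≤
            (HomogeneousIdeal.irrelevant (MvPolynomial.homogeneousSubmodule (Fin (n + 1)) O)).map φ),
          (∀ s, φ s = MvPolynomial.map π s) →
          ∀ Y : Set (AlgebraicGeometry.Proj (MvPolynomial.homogeneousSubmodule (Fin (n + 1)) O)),
            Y = Set.range (ι ≫ AlgebraicGeometry.Proj.map φ hφ' :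
              H ⟶ AlgebraicGeometry.Proj (MvPolynomial.homogeneousSubmodule (Fin (n + 1)) O)) →
            ∃ (P' : AlgebraicGeometry.Scheme.{0})
              (σ : P' ⟶ AlgebraicGeometry.Proj (MvPolynomial.homogeneousSubmodule (Fin (n + 1)) O)) (S' : Set P'),
              (∀ Q : (∀ X' : AlgebraicGeometry.Scheme.{0},
                  (X' ⟶ AlgebraicGeometry.Proj (MvPolynomial.homogeneousSubmodule (Fin (n + 1)) O)) → Set X' → Prop),
                Q (AlgebraicGeometry.Proj (MvPolynomial.homogeneousSubmodule (Fin (n + 1)) O)) (𝟙 _) Y →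
                (∀ (X' X'' : AlgebraicGeometry.Scheme.{0})
                    (σ' : X' ⟶ AlgebraicGeometry.Proj (MvPolynomial.homogeneousSubmodule (Fin (n + 1)) O)) (Y' : Set X')
                    (C : X'.IdealSheafData) (τ : X'' ⟶ X'),
                  Q X' σ' Y' → Literature.AlgebraicGeometry.Resolution.IsBlowup τ C →
                  Literature.AlgebraicGeometry.Resolution.Scheme.IsRegular C.subscheme →
                  AlgebraicGeometry.Flat (C.subschemeι ≫ σ' ≫
                    AlgebraicGeometry.Proj.toSpecZero (MvPolynomial.homogeneousSubmodule (Fin (n + 1)) O) ≫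
                      AlgebraicGeometry.Spec.map (CommRingCat.ofHom
                        (algebraMap O (MvPolynomial.homogeneousSubmodule (Fin (n + 1)) O 0)))) →
                  σ' '' (C.support : Set X') ⊆ {x | ¬ IsGenericPoint x Y} →
                  (C.support : Set X') ∩ (σ' ≫
                    AlgebraicGeometry.Proj.toSpecZero (MvPolynomial.homogeneousSubmodule (Fin (n + 1)) O) ≫
                      AlgebraicGeometry.Spec.map (CommRingCat.ofHom
                        (algebraMap O (MvPolynomial.homogeneousSubmodule (Fin (n + 1)) O 0)))) ⁻¹'
                      {IsLocalRing.closedPoint O} ⊆ Y' →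
                  Q X'' (τ ≫ σ') (closure (τ ⁻¹' (Y' \ (C.support : Set X'))))) →
                Q P' σ S') ∧
              Literature.AlgebraicGeometry.Resolution.Scheme.IsRegular
                (AlgebraicGeometry.Scheme.IdealSheafData.vanishingIdeal
                  (⟨closure S', isClosed_closure⟩ : TopologicalSpace.Closeds P')).subscheme) := by
  classical
  intro hp k _ _ _ n H ι hι hH hpr Reach HSUB hres
  obtain ⟨O, i1, i2, i3, i4, i5, i6, π, hπ⟩ := stub_wittRing p hp k
  refine ⟨O, i1, i2, i3, i4, π, hπ, ?_⟩
  letI := MvPolynomial.gradedAlgebra (σ := Fin (n + 1)) (R := O)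
  letI := MvPolynomial.gradedAlgebra (σ := Fin (n + 1)) (R := k)
  intro φ hφ' hφ Y hYdef
  subst hYdef
  -- the fixed ambient `P = ℙⁿ_O`, `q`, and the BASE MODEL SQUARE `g : ℙⁿ_k → ℙⁿ_O`
  set q : Proj (homogeneousSubmodule (Fin (n + 1)) O) ⟶ Spec (.of O) :=
    Proj.toSpecZero (homogeneousSubmodule (Fin (n + 1)) O) ≫
      Spec.map (CommRingCat.ofHom (algebraMap O (homogeneousSubmodule (Fin (n + 1)) O 0))) with hq
  have hP := ProjectiveAmbientFibre.isPullback_projMap π φ hφ hπ hφ'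
  set g : Proj (homogeneousSubmodule (Fin (n + 1)) k) ⟶ Proj (homogeneousSubmodule (Fin (n + 1)) O) :=
    Proj.map φ hφ' with hg
  haveI : IsClosedImmersion (Spec.map (CommRingCat.ofHom π)) := IsClosedImmersion.spec_of_surjective _ hπ
  haveI : IsClosedImmersion g := MorphismProperty.IsStableUnderBaseChange.of_isPullback hP.flip inferInstance
  have hsq₀ : IsPullback g (Proj.toSpecZero (homogeneousSubmodule (Fin (n + 1)) k) ≫
      Spec.map (CommRingCat.ofHom (algebraMap k (homogeneousSubmodule (Fin (n + 1)) k 0))))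
      (𝟙 _ ≫ q) (Spec.map (CommRingCat.ofHom π)) := by
    rw [Category.id_comp]; exact hP
  have hrangeg : Set.range g = q ⁻¹' {IsLocalRing.closedPoint O} := by
    rw [range_eq_preimage_of_isPullback hP, range_specMap_of_surjective_of_field π hπ]
  -- the closed immersion `f = ι ≫ g : H ⟶ ℙⁿ_O` and its (closed) range `Y`
  haveI := hH
  let ι' : H ⟶ Proj (homogeneousSubmodule (Fin (n + 1)) k) := ι
  haveI : IsClosedImmersion ι' := hι
  let f : H ⟶ Proj (homogeneousSubmodule (Fin (n + 1)) O) := ι' ≫ g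
  let Yc : Closeds (Proj (homogeneousSubmodule (Fin (n + 1)) O)) := ⟨Set.range f, f.isClosedEmbedding.isClosed_range⟩
  have hYc : (Yc : Set (Proj (homogeneousSubmodule (Fin (n + 1)) O))) = Set.range (ι ≫ Proj.map φ hφ') := rfl
  have hsub : (Yc : Set (Proj (homogeneousSubmodule (Fin (n + 1)) O))) ⊆ q ⁻¹' {IsLocalRing.closedPoint O} := by
    rintro _ ⟨x, rfl⟩
    rw [← hrangeg]
    exact ⟨ι' x, (Scheme.Hom.comp_apply _ _ x).symm⟩
  obtain ⟨hsm, hprop⟩ := stub_projectiveAmbientSmoothProper O n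
  haveI : IsProper q := hprop
  -- `Y` is irreducible (image of the integral `H`)
  have hYirr : IsIrreducible (Yc : Set (Proj (homogeneousSubmodule (Fin (n + 1)) O))) := by
    have h := (IrreducibleSpace.isIrreducible_univ H).image f f.continuous.continuousOn
    rwa [Set.image_univ] at h
  obtain ⟨ξ, hξ⟩ : ∃ ξ : Proj (homogeneousSubmodule (Fin (n + 1)) O), IsGenericPoint ξ (Yc : Set _) :=
    QuasiSober.sober hYirr Yc.isClosed
  -- EL♮'s HORIZONTAL induction principle as a stage predicate over the fixed base
  obtain ⟨Ch, hCh⟩ : ∃ Ch : ∀ X' : Scheme.{0}, (X' ⟶ Proj (homogeneousSubmodule (Fin (n + 1)) O)) → Set X' → Prop,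
      ∀ (X₁ : Scheme.{0}) (σ₁ : X₁ ⟶ Proj (homogeneousSubmodule (Fin (n + 1)) O)) (S₁ : Set X₁), Ch X₁ σ₁ S₁ ↔
      ∀ Q : (∀ X' : Scheme.{0}, (X' ⟶ Proj (homogeneousSubmodule (Fin (n + 1)) O)) → Set X' → Prop),
        Q (Proj (homogeneousSubmodule (Fin (n + 1)) O)) (𝟙 _) (Yc : Set (Proj (homogeneousSubmodule (Fin (n + 1)) O))) →
        (∀ (X' X'' : Scheme.{0}) (σ' : X' ⟶ Proj (homogeneousSubmodule (Fin (n + 1)) O)) (Y' : Set X')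
          (C : X'.IdealSheafData) (τ : X'' ⟶ X'), Q X' σ' Y' → IsBlowup τ C → Scheme.IsRegular C.subscheme →
          Flat (C.subschemeι ≫ σ' ≫ q) →
          σ' '' (C.support : Set X') ⊆ {x | ¬ IsGenericPoint x (Yc : Set (Proj (homogeneousSubmodule (Fin (n + 1)) O)))} →
          (C.support : Set X') ∩ (σ' ≫ q) ⁻¹' {IsLocalRing.closedPoint O} ⊆ Y' →
          Q X'' (τ ≫ σ') (closure (τ ⁻¹' (Y' \ (C.support : Set X'))))) →
        Q X₁ σ₁ S₁ := ⟨_, fun _ _ _ => Iff.rfl⟩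
  have hChain : ∀ (X' : Scheme.{0}) (σ : X' ⟶ Proj (homogeneousSubmodule (Fin (n + 1)) O)) (S : Set X'),
      Ch X' σ S → Chain (Proj (homogeneousSubmodule (Fin (n + 1)) O))
        (Yc : Set (Proj (homogeneousSubmodule (Fin (n + 1)) O))) X' σ S :=
    fun X' σ S h Q h0 hs => (hCh X' σ S).mp h Q h0
      (fun X₁ X₂ σ' Y' C τ hQ hb hr _ hg' _ => hs X₁ X₂ σ' Y' C τ hQ hb hr hg')
  have hStep : ∀ (X' X'' : Scheme.{0}) (σ' : X' ⟶ Proj (homogeneousSubmodule (Fin (n + 1)) O)) (S' : Set X')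
      (C : X'.IdealSheafData) (τ : X'' ⟶ X'),
      Ch X' σ' S' → IsBlowup τ C → Scheme.IsRegular C.subscheme → Flat (C.subschemeι ≫ σ' ≫ q) →
      σ' '' (C.support : Set X') ⊆ {x | ¬ IsGenericPoint x (Yc : Set (Proj (homogeneousSubmodule (Fin (n + 1)) O)))} →
      (C.support : Set X') ∩ (σ' ≫ q) ⁻¹' {IsLocalRing.closedPoint O} ⊆ S' →
      Ch X'' (τ ≫ σ') (closure (τ ⁻¹' (S' \ (C.support : Set X')))) :=
    fun X' X'' σ' S' C τ h hb hr hfl hg' hE => (hCh _ _ _).mpr fun Q h0 hs =>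
      hs X' X'' σ' S' C τ ((hCh X' σ' S').mp h Q h0 hs) hb hr hfl hg' hE
  have hCh₀ : Ch (Proj (homogeneousSubmodule (Fin (n + 1)) O)) (𝟙 _)
      (Yc : Set (Proj (homogeneousSubmodule (Fin (n + 1)) O))) := (hCh _ _ _).mpr fun Q h0 _ => h0
  have hPnoeth : IsLocallyNoetherian (Proj (homogeneousSubmodule (Fin (n + 1)) O)) :=
    LocallyOfFiniteType.isLocallyNoetherian q
  have hPreg : Scheme.IsRegular (Proj (homogeneousSubmodule (Fin (n + 1)) O)) := fun y => (stub_goodAtOfSmooth O _ q hsm y).1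
  -- THE INDUCTION PREDICATE: closed irreducible strict transform in an integral ambient which IS the special fibre of an upstairs
  -- horizontal-E1 stage (the MODEL SQUARE), with matching strict-transform sets
  let QD : ∀ F₁ : Scheme.{0}, (F₁ ⟶ (Literature.AlgebraicGeometry.Motives.projectiveSpace n k).left) → Set F₁ → Prop :=
    fun F₁ _ T₁ => IsClosed T₁ ∧ IsIrreducible T₁ ∧ IsIntegral F₁ ∧
      ∃ (X' : Scheme.{0}) (σ' : X' ⟶ Proj (homogeneousSubmodule (Fin (n + 1)) O)) (S' : Set X')
        (j : F₁ ⟶ X') (t : F₁ ⟶ Spec (.of k)),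
        Ch X' σ' S' ∧ IsIntegral X' ∧ IsLocallyNoetherian X' ∧ Scheme.IsRegular X' ∧ IsDominant (σ' ≫ q) ∧
        IsPullback j t (σ' ≫ q) (Spec.map (CommRingCat.ofHom π)) ∧ j '' T₁ = S'
  -- THE INDUCTION along the downstairs closure
  obtain ⟨F', ρ', T', hclos, hregD⟩ := hres
  have hQD : QD F' ρ' T' := by
    refine hclos QD ?_ ?_
    · -- BASE: `(ℙⁿ_k, 𝟙, range ι)` IS the special fibre of `(ℙⁿ_O, 𝟙, Y)`
      haveI : Nonempty H := inferInstance
      haveI : Nonempty (Proj (homogeneousSubmodule (Fin (n + 1)) O)) := ⟨f (Classical.arbitrary H)⟩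
      haveI : Smooth q := hsm
      haveI : IsDominant q := isDominant_of_smooth_of_nonempty q
      have hdom₀ : IsDominant (𝟙 (Proj (homogeneousSubmodule (Fin (n + 1)) O)) ≫ q) := by
        rw [Category.id_comp]; infer_instance
      have hirrι : IsIrreducible (Set.range ι') := by
        have h := (IrreducibleSpace.isIrreducible_univ H).image ι' ι'.continuous.continuousOn
        rwa [Set.image_univ] at h
      refine ⟨ι'.isClosedEmbedding.isClosed_range, hirrι, isIntegral_proj_homogeneousSubmodule n k, _, 𝟙 _,
        (Yc : Set (Proj (homogeneousSubmodule (Fin (n + 1)) O))), g, _, hCh₀,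
        Proj.isIntegral _ (irrelevant_homogeneousSubmodule_ne_bot n O), hPnoeth, hPreg, hdom₀, hsq₀, ?_⟩
      change g '' Set.range ι' = Set.range f
      rw [← Set.range_comp]
      rfl
    · -- STEPS
      intro F₁ F₂ ρ T₁ x υ hx hQ₁ hxreg hFreg hυ
      obtain ⟨hT₁cl, hT₁irr, hF₁, X', σ', S', j, t, hChX, hX'int, hX'noeth, hX'reg, hdom, hsq, hTS⟩ := hQ₁
      haveI := hF₁
      haveI := hX'int
      haveI := hX'noeth
      obtain ⟨hF₂, hT₂irr, U, s, X'', τ, j₂, t₂, hproper, hU, hs, hsU, hss₀, hoffs, hτ, hcomm, hE, hCh'', hint'', hnoeth'',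
        hreg'', hdom'', hsq₂⟩ := modelPointStep_chain' O k π hπ _ q (Yc : Set (Proj (homogeneousSubmodule (Fin (n + 1)) O))) hsub hYirr
          Yc.isClosed hPnoeth hPreg Ch hChain hStep X' σ' S' hChX hX'reg hdom F₁ j t hsq T₁ hT₁cl hT₁irr hTS x hx hxreg hFreg
          F₂ υ hυ
      haveI := hF₂
      haveI := hint''
      haveI := hnoeth''
      haveI hj₂ci : IsClosedImmersion j₂ := MorphismProperty.IsStableUnderBaseChange.of_isPullback hsq₂.flip inferInstance
      refine ⟨⟨isClosed_closure, hT₂irr, hF₂, X'', τ ≫ σ', _, j₂, t₂, hCh'', hint'', hnoeth'', hreg'', hdom'', hsq₂, rfl⟩, ?_⟩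
      -- the sub-chain: handed to the supplier
      intro F₉ β T₉ hReach
      -- T-DIM: the running ambient has local dimension `n + 1` at the section point
      haveI hjci : IsClosedImmersion j := MorphismProperty.IsStableUnderBaseChange.of_isPullback hsq.flip inferInstance
      have hwcl : IsClosed ({s (IsLocalRing.closedPoint O)} : Set X') := by
        rw [hss₀]
        have h := hjci.isClosedEmbedding.isClosedMap _ hx
        rwa [Set.image_singleton] at h
      have hws₀ : (σ' ≫ q).base (s (IsLocalRing.closedPoint O)) = IsLocalRing.closedPoint O := by
        change (s ≫ σ' ≫ q) (IsLocalRing.closedPoint O) = _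
        rw [hs]; rfl
      haveI hPint : IsIntegral (Proj (homogeneousSubmodule (Fin (n + 1)) O)) :=
        Proj.isIntegral _ (irrelevant_homogeneousSubmodule_ne_bot n O)
      haveI hsrd : SmoothOfRelativeDimension n q := smoothOfRelativeDimension_toSpecZero_specMap n O
      have hdim : ringKrullDim (X'.presheaf.stalk (s (IsLocalRing.closedPoint O))) = ((n + 1 : ℕ) : WithBot ℕ∞) :=
        ringKrullDim_stalk_eq_succ_of_chain q n hξ (hChain _ _ _ hChX) hwcl hws₀
      obtain ⟨X₉, σ₉, S₉, j₉, t₉, hCh₉, hint₉, hnoeth₉, hreg₉, hdom₉, hsq₉, hsets₉, hT₉cl, hT₉irr, hF₉⟩ :=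
        HSUB O π hπ _ q (Yc : Set (Proj (homogeneousSubmodule (Fin (n + 1)) O))) Ch hStep hChain hsub hYirr Yc.isClosed
          hPint hPnoeth hPreg hprop hsrd X' σ' S' hChX hX'int hX'noeth hX'reg hdom F₁ hF₁ j t hsq T₁ hT₁cl hT₁irr hTS _ hx U
          hU s hs hsU hss₀ hdim X'' τ hτ hint'' hnoeth'' hreg'' hdom'' F₂ hF₂ υ hυ j₂ t₂ hsq₂ hcomm hE hT₂irr hCh'' F₉ β T₉
          hReach
      exact ⟨hT₉cl, hT₉irr, hF₉, X₉, σ₉, S₉, j₉, t₉, hCh₉, hint₉, hnoeth₉, hreg₉, hdom₉, hsq₉, hsets₉⟩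
  -- THE END: transport the downstairs regularity through the model
  obtain ⟨hT'cl, -, -, X₁, σ₁, S₁, j₁, t₁, hCh₁, -, -, -, -, hsq₁, hTS₁⟩ := hQD
  haveI hj₁ci : IsClosedImmersion j₁ := MorphismProperty.IsStableUnderBaseChange.of_isPullback hsq₁.flip inferInstance
  have hT'img : IsClosed (j₁ '' T') := hj₁ci.isClosedEmbedding.isClosedMap _ hT'cl
  have hZ1 : (⟨closure T', isClosed_closure⟩ : Closeds F') = ⟨T', hT'cl⟩ := Closeds.ext hT'cl.closure_eq
  have hZ2 : (⟨closure S₁, isClosed_closure⟩ : Closeds X₁) = ⟨j₁ '' T', hT'img⟩ :=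
    Closeds.ext (by change closure S₁ = j₁ '' T'; rw [← hTS₁]; exact hT'img.closure_eq)
  rw [hZ1] at hregD
  refine ⟨X₁, σ₁, S₁, (hCh X₁ σ₁ S₁).mp hCh₁, ?_⟩
  rw [hZ2]
  exact (isRegular_subscheme_vanishingIdeal_image_iff j₁ ⟨T', hT'cl⟩ hT'img).mpr hregD

end Summit.ResolutionOfSingularities.ResolutionOfSingularities.Cruxes.EquisingularLiftNat.Sections

end
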